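import Literature.NumberTheory.Sieve.FordMaynardSliceConvolution
import Literature.NumberTheory.Sieve.FordMaynardSlicePermutation
import Literature.NumberTheory.Sieve.FordMaynardFragmentationSymm
import Mathlib.Analysis.MeanInequalities

/-!
# Route `FordMaynardNoSieveConst0164`, crux `NegWitness0164` (stmt-Parity-19102), line `birth`,
# stub `stub_tweakNeg0164`: slice-integral tools for the dimension-5 cell integrals of (I')

Helper file (def-free) for the numerical target (I') of `…NegWitness0164Numerics`
(K. Ford, J. Maynard, *On the theory of prime producing sieves*, arXiv:2407.14368, §8): the 97 cell integrals
`∫_{Δ₅(1)} 𝟙[v ∈ cell t]/∏v` are bounded below WITHOUT interval arithmetic, by the tangent plane of the convex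
function `1/∏vᵢ` at the centroid of the slice cell.  This file provides the four generic tools:

* `sliceIntegral_translate` — translation of the integrand by a nonnegative vector `a` shifts the slice
  parameter: `∫_{Δ_{d+1}(w)} G = ∫_{Δ_{d+1}(w − Σa)} G(· + a)` when `G` vanishes unless `v > a`;
* `sliceIntegral_mono_of` — monotonicity of slice integrals (bounded measurable integrands);
* `inv_prod_tangent_le` — the AM–GM tangent-plane inequality `(1/∏pᵢ)(6 − Σ vᵢ/pᵢ) ≤ 1/∏vᵢ` on `(0,∞)⁵`;
* `sliceIntegral_box_mul_linear` — first moments of the symmetric box slice: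
  `∫_{Δ₅(S)} 𝟙[0 < vᵢ < w] (Σ cᵢvᵢ) = (S/5)(Σ cᵢ) ∫_{Δ₅(S)} 𝟙[0 < vᵢ < w]`.

References: [FordMaynard2024PrimeSieves] arXiv:2407.14368, §8 (proof of Theorem 2.7 (c)); the convexity bound is folklore
(Jensen / tangent plane for `v ↦ ∏ vᵢ⁻¹`).
-/

noncomputable section

open Finset MeasureTheory Set
open scoped Classical
open Literature.NumberTheory.Sieve Literature.NumberTheory.Sieve.FordMaynard

namespace Summit.Parity.GeneralizedHardyLittlewood.FordMaynardNoSieveConst0164NegWitness0164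

/-! ### Translation of slice integrals -/

/-- **Translation of a slice integral.** If `a ≥ 0` componentwise and `G(v) = 0` unless `vᵢ > aᵢ` for all `i`,
then `∫_{v ∈ (0,∞)^{d+1}, Σv = w} G(v) = ∫_{v' ∈ (0,∞)^{d+1}, Σv' = w − Σaᵢ} G(v' + a)` (substitute `v = v' + a`).
[folklore] -/
theorem sliceIntegral_translate (d : ℕ) (w : ℝ) (a : Fin (d + 1) → ℝ) (ha : ∀ i, 0 ≤ a i)
    (G : (Fin (d + 1) → ℝ) → ℝ) (hG : ∀ v, (∃ i, v i ≤ a i) → G v = 0) :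
    sliceIntegral (d + 1) w G = sliceIntegral (d + 1) (w - ∑ i, a i) (fun v => G (v + a)) := by
  rw [sliceIntegral_succ_eq, sliceIntegral_succ_eq]
  set a' : Fin d → ℝ := fun i => a (Fin.castSucc i) with ha'
  rw [← integral_add_right_eq_self (sliceIntegrand d w G) a']
  refine integral_congr_ae (Filter.Eventually.of_forall fun u => ?_)
  show sliceIntegrand d w G (u + a') = sliceIntegrand d (w - ∑ i, a i) (fun v => G (v + a)) u
  have hsum : ∑ i, a i = ∑ i, a' i + a (Fin.last d) := Fin.sum_univ_castSucc a
  have hsnoc : (Fin.snoc (u + a') (w - ∑ i, (u + a') i) : Fin (d + 1) → ℝ) =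
      Fin.snoc u (w - ∑ i, a i - ∑ i, u i) + a := by
    funext i
    refine Fin.lastCases ?_ (fun j => ?_) i
    · simp only [Fin.snoc_last, Pi.add_apply, Finset.sum_add_distrib]
      rw [hsum]; ring
    · simp only [Fin.snoc_castSucc, Pi.add_apply, ha']
  unfold sliceIntegrand
  rw [hsnoc]
  by_cases hR : (∀ i, 0 < u i) ∧ ∑ i, u i < w - ∑ i, a i
  · have hL : (∀ i, 0 < (u + a') i) ∧ ∑ i, (u + a') i < w := by
      refine ⟨fun i => ?_, ?_⟩
      · simp only [Pi.add_apply]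
        have := hR.1 i
        have := ha (Fin.castSucc i)
        linarith
      · simp only [Pi.add_apply, Finset.sum_add_distrib]
        have := ha (Fin.last d)
        linarith [hR.2]
    rw [if_pos hL, if_pos hR]
  · rw [if_neg hR]
    split_ifs with hL
    · apply hG
      rw [not_and_or] at hR
      rcases hR with h1 | h2
      · push Not at h1
        obtain ⟨i, hi⟩ := h1
        refine ⟨Fin.castSucc i, ?_⟩
        simp only [Pi.add_apply, Fin.snoc_castSucc]
        linarith
      · refine ⟨Fin.last d, ?_⟩
        simp only [Pi.add_apply, Fin.snoc_last]
        linarith [not_lt.1 h2]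
    · rfl

/-! ### Monotonicity -/

/-- **Monotonicity of slice integrals**: for measurable integrands bounded on the slice, `G ≤ G'` on the slice
implies `∫_{Δ(w)} G ≤ ∫_{Δ(w)} G'`. [folklore] -/
theorem sliceIntegral_mono_of (d : ℕ) (w : ℝ) {G G' : (Fin (d + 1) → ℝ) → ℝ}
    (hG : Measurable G) (hG' : Measurable G') {C : ℝ} (hC : 0 ≤ C)
    (hGb : ∀ v : Fin (d + 1) → ℝ, (∀ i, 0 < v i) → ∑ i, v i = w → |G v| ≤ C)
    (hG'b : ∀ v : Fin (d + 1) → ℝ, (∀ i, 0 < v i) → ∑ i, v i = w → |G' v| ≤ C)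
    (hle : ∀ v : Fin (d + 1) → ℝ, (∀ i, 0 < v i) → ∑ i, v i = w → G v ≤ G' v) :
    sliceIntegral (d + 1) w G ≤ sliceIntegral (d + 1) w G' := by
  rw [sliceIntegral_succ_eq, sliceIntegral_succ_eq]
  refine integral_mono (integrable_sliceIntegrand d w hG hC hGb) (integrable_sliceIntegrand d w hG' hC hG'b)
    fun u => ?_
  show sliceIntegrand d w G u ≤ sliceIntegrand d w G' u
  unfold sliceIntegrand
  split_ifs with hu
  · refine hle _ (fun i => ?_) ?_
    · refine Fin.lastCases ?_ (fun j => ?_) i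
      · simp only [Fin.snoc_last]; linarith [hu.2]
      · simp only [Fin.snoc_castSucc]; exact hu.1 j
    · rw [Fin.sum_univ_castSucc]; simp
  · exact le_rfl

/-! ### The tangent plane of `v ↦ 1/∏ vᵢ` -/

/-- **AM–GM tangent-plane bound** for the convex function `v ↦ 1/(v₀⋯v₄)` on `(0,∞)⁵`: for all `v, p > 0`,
`(1/∏pᵢ)·(6 − Σᵢ vᵢ/pᵢ) ≤ 1/∏vᵢ` (AM–GM `∏(vᵢ/pᵢ) ≤ u⁵`, `u` the mean of `vᵢ/pᵢ`, and `u⁵(6 − 5u) ≤ 1`). [folklore] -/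
theorem inv_prod_tangent_le (v p : Fin 5 → ℝ) (hv : ∀ i, 0 < v i) (hp : ∀ i, 0 < p i) :
    1 / (∏ i, p i) * (6 - ∑ i, v i / p i) ≤ 1 / ∏ i, v i := by
  set z : Fin 5 → ℝ := fun i => v i / p i with hz
  have hz0 : ∀ i, 0 < z i := fun i => div_pos (hv i) (hp i)
  set u : ℝ := (∑ i, z i) / 5 with hu
  have hprod0 : 0 ≤ ∏ i, z i := Finset.prod_nonneg fun i _ => (hz0 i).le
  have hu0 : 0 ≤ u := by
    rw [hu]; exact div_nonneg (Finset.sum_nonneg fun i _ => (hz0 i).le) (by norm_num)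
  -- AM–GM
  have hamgm : ∏ i, z i ≤ u ^ 5 := by
    have h := Real.geom_mean_le_arith_mean_weighted (Finset.univ : Finset (Fin 5)) (fun _ => (1 / 5 : ℝ)) z
      (fun i _ => by norm_num) (by simp) (fun i _ => (hz0 i).le)
    rw [Real.finsetProd_rpow _ _ (fun i _ => (hz0 i).le)] at h
    have hsum : ∑ i, (1 / 5 : ℝ) * z i = u := by rw [← Finset.mul_sum, hu]; ring
    rw [hsum] at h
    calc ∏ i, z i = ((∏ i, z i) ^ (1 / 5 : ℝ)) ^ (5 : ℕ) := by
          rw [← Real.rpow_natCast, ← Real.rpow_mul hprod0]; norm_num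
      _ ≤ u ^ 5 := by gcongr
  have hpv : 0 < ∏ i, v i := Finset.prod_pos fun i _ => hv i
  have hpp : 0 < ∏ i, p i := Finset.prod_pos fun i _ => hp i
  have hprodz : ∏ i, z i = (∏ i, v i) / ∏ i, p i := by
    rw [hz]; simp only [Finset.prod_div_distrib]
  have hsumz : ∑ i, v i / p i = 5 * u := by rw [hu, hz]; ring
  rw [hsumz, div_mul_eq_mul_div, one_mul, div_le_div_iff₀ hpp hpv, one_mul]
  by_cases h6 : 6 - 5 * u ≤ 0
  · nlinarith
  · push Not at h6
    have key : u ^ 5 * (6 - 5 * u) ≤ 1 := by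
      have hfac : 1 - u ^ 5 * (6 - 5 * u) = (1 - u) ^ 2 * (1 + 2 * u + 3 * u ^ 2 + 4 * u ^ 3 + 5 * u ^ 4) := by
        ring
      nlinarith [sq_nonneg (1 - u), hfac, pow_nonneg hu0 2, pow_nonneg hu0 3, pow_nonneg hu0 4]
    have hzv : (∏ i, z i) * ∏ i, p i = ∏ i, v i := by
      rw [hprodz]; field_simp
    calc (6 - 5 * u) * ∏ i, v i = ((6 - 5 * u) * ∏ i, z i) * ∏ i, p i := by rw [← hzv]; ring
      _ ≤ ((6 - 5 * u) * u ^ 5) * ∏ i, p i := by gcongr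
      _ ≤ 1 * ∏ i, p i := by gcongr; linarith [key]
      _ = ∏ i, p i := one_mul _

/-! ### First moments of the symmetric box slice -/

/-- The open box indicator `𝟙[0 < vᵢ < w ∀ i]` is invariant under permutations of the coordinates. [folklore] -/
theorem box_indicator_comp_perm (w : ℝ) (σ : Equiv.Perm (Fin 5)) (v : Fin 5 → ℝ) :
    (if ∀ i, 0 < (v ∘ σ) i ∧ (v ∘ σ) i < w then (1 : ℝ) else 0) =
      if ∀ i, 0 < v i ∧ v i < w then (1 : ℝ) else 0 := by
  have hiff : (∀ i, 0 < (v ∘ σ) i ∧ (v ∘ σ) i < w) ↔ ∀ i, 0 < v i ∧ v i < w := by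
    constructor
    · intro h i; simpa using h (σ.symm i)
    · intro h i; exact h (σ i)
  simp only [hiff]

/-- The set `{v | ∀ i, 0 < vᵢ < w}` is measurable. [folklore] -/
theorem measurableSet_box (w : ℝ) : MeasurableSet {v : Fin 5 → ℝ | ∀ i, 0 < v i ∧ v i < w} := by
  have : {v : Fin 5 → ℝ | ∀ i, 0 < v i ∧ v i < w} = ⋂ i, {v | 0 < v i ∧ v i < w} := by ext v; simp
  rw [this]
  exact MeasurableSet.iInter fun i =>
    (measurableSet_lt measurable_const (measurable_pi_apply i)).inter
      (measurableSet_lt (measurable_pi_apply i) measurable_const)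

/-- Over each cyclic shift, `Σ_k v(i + k) = Σ_j v_j`. [folklore] -/
theorem sum_shift_eq (v : Fin 5 → ℝ) (i : Fin 5) : ∑ k : Fin 5, v (i + k) = ∑ j, v j :=
  Fintype.sum_equiv (Equiv.addLeft i) _ _ (fun _ => rfl)

/-- **First moments of the symmetric box slice by symmetry.** For the open box `B = 𝟙[0 < vᵢ < w ∀ i]` and any
linear form `Σ cᵢvᵢ`: `∫_{Δ₅(S)} B·(Σ cᵢvᵢ) = (S/5)(Σ cᵢ)·∫_{Δ₅(S)} B` (average over the five cyclic shifts of the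
coordinates, under which `B` and the slice are invariant and `Σ_k v_{i+k} = S`). [folklore] -/
theorem sliceIntegral_box_mul_linear (w S : ℝ) (c : Fin 5 → ℝ) :
    sliceIntegral 5 S (fun v => (if ∀ i, 0 < v i ∧ v i < w then (1 : ℝ) else 0) * ∑ i, c i * v i) =
      S / 5 * (∑ i, c i) * sliceIntegral 5 S (fun v => if ∀ i, 0 < v i ∧ v i < w then (1 : ℝ) else 0) := by
  set B : (Fin 5 → ℝ) → ℝ := fun v => if ∀ i, 0 < v i ∧ v i < w then (1 : ℝ) else 0 with hB
  have hBm : Measurable B := Measurable.ite (measurableSet_box w) measurable_const measurable_const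
  have hBsymm : ∀ (σ : Equiv.Perm (Fin 5)) (v : Fin 5 → ℝ), B (v ∘ σ) = B v :=
    fun σ v => box_indicator_comp_perm w σ v
  have hBbd : ∀ v, B v ≠ 0 → ∀ j, |v j| ≤ |w| := by
    intro v hv j
    have h : ∀ i, 0 < v i ∧ v i < w := by
      by_contra h; exact hv (by simp only [hB, if_neg h])
    rw [abs_of_pos (h j).1]
    exact (h j).2.le.trans (le_abs_self w)
  -- each cyclic shift of the linear form has the same integral against `B`
  have h1 : ∀ k : Fin 5, sliceIntegral 5 S (fun v => B v * ∑ i, c i * v (i + k)) =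
      sliceIntegral 5 S (fun v => B v * ∑ i, c i * v i) := by
    intro k
    have := sliceIntegral_comp_perm S (Equiv.addRight k) (fun v => B v * ∑ i, c i * v i)
    rw [← this]
    refine congrArg (sliceIntegral 5 S) (funext fun v => ?_)
    rw [hBsymm]
    simp only [Function.comp_apply, Equiv.coe_addRight]
  -- global bound for the shifted integrands
  have hbd : ∀ (k : Fin 5) (v : Fin 5 → ℝ), |B v * ∑ i, c i * v (i + k)| ≤ (∑ i, |c i|) * |w| := by
    intro k v
    by_cases hv : B v = 0
    · rw [hv, zero_mul, abs_zero]; positivity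
    · have hB1 : B v = 1 := by
        simp only [hB] at hv ⊢; split_ifs with h
        · rfl
        · simp [h] at hv
      rw [hB1, one_mul]
      refine (Finset.abs_sum_le_sum_abs _ _).trans ?_
      rw [Finset.sum_mul]
      refine Finset.sum_le_sum fun i _ => ?_
      rw [abs_mul]
      exact mul_le_mul_of_nonneg_left (hBbd v hv _) (abs_nonneg _)
  have hmeas : ∀ k : Fin 5, Measurable (fun v : Fin 5 → ℝ => B v * ∑ i, c i * v (i + k)) := fun _ =>
    hBm.mul (Finset.measurable_sum _ fun i _ => measurable_const.mul (measurable_pi_apply _))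
  -- sum over the five shifts
  have h2 : (5 : ℝ) * sliceIntegral 5 S (fun v => B v * ∑ i, c i * v i) =
      sliceIntegral 5 S (fun v => ∑ k : Fin 5, B v * ∑ i, c i * v (i + k)) := by
    rw [sliceIntegral_finset_sum Finset.univ 5 S (fun k v => B v * ∑ i, c i * v (i + k)) hmeas
      (C := (∑ i, |c i|) * |w|) hbd]
    simp only [h1, Finset.sum_const, Finset.card_univ, Fintype.card_fin, nsmul_eq_mul, Nat.cast_ofNat]
  -- the sum of the shifted forms is `(Σ c)·(Σ v) = (Σ c)·S` on the slice
  have h3 : sliceIntegral 5 S (fun v => ∑ k : Fin 5, B v * ∑ i, c i * v (i + k)) =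
      sliceIntegral 5 S (fun v => ((∑ i, c i) * S) * B v) := by
    refine sliceIntegral_congr fun v _ hvS => ?_
    rw [← Finset.mul_sum]
    have : ∑ k : Fin 5, ∑ i, c i * v (i + k) = (∑ i, c i) * S := by
      rw [Finset.sum_comm]
      simp_rw [← Finset.mul_sum, sum_shift_eq v, hvS]
      rw [Finset.sum_mul]
    rw [this]; ring
  rw [h3, sliceIntegral_const_mul] at h2
  have : sliceIntegral 5 S (fun v => B v * ∑ i, c i * v i) = S / 5 * (∑ i, c i) * sliceIntegral 5 S B := by
    linarith
  exact this

end Summit.Parity.GeneralizedHardyLittlewood.FordMaynardNoSieveConst0164NegWitness0164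

end
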